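import Literature.Geometry.Lorentzian.ObstructionFreeGluing

/-!
# Stub `stub_plugDataPlusFrom_of` of the line `Sketch` (crux `SwallowTheDatum.UniversalWitnessFamily`,
# item stmt-FinalStateConjecture-10051) — helper file 2: locality of the Mao–Oh–Tao hypotheses; the flat in-fields

The hypothesis block of Mao–Oh–Tao Thm 1.7 (vendored as `MaoOhTao.ObstructionFreeAnnularGluing`) reads the in-fields only near
the closed annulus `{1 ≤ |x| ≤ 2}` and the out-fields only near `{32 ≤ |x| ≤ 64}`.  This file proves the corresponding
CONGRUENCES (everything proved; no named facts):

* §1 `wt η r x = 0` off the open annulus `{r < |x| < 2r}` for an admissible bump (`supp η ⊆ [1, 2]`); hence the averaged charges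
  `avgE, avgP, avgC, avgJ` at radius `r` of two coefficient fields agreeing on an open set containing that annulus coincide
  (the integrands agree pointwise: components and their coordinate derivatives are local, `Filter.EventuallyEq.fderiv_eq`);
* §2 the `C² × C¹` deviation `DevLE` on `{a ≤ |x| ≤ b}` transfers along agreement on an open set containing the closed annulus
  (`Filter.EventuallyEq.iteratedFDeriv`);
* §3 the flat pair `(δ, 0)`: deviation `0` and all averaged charges `0`.

References: Mao–Oh–Tao arXiv:2308.13031, §1.2 (1.3)–(1.7).
-/

-- the doubled `FinalStateConjecture` path component is the summit/problem naming scheme, not a mistake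
set_option linter.dupNamespace false

noncomputable section

namespace Summit.FinalStateConjecture.FinalStateConjecture.Theorems.SwallowTheDatum.UniversalWitnessFamily

open scoped Topology BigOperators InnerProductSpace
open Set Filter Function MeasureTheory Literature.Geometry.Lorentzian Literature.Geometry.Lorentzian.MaoOhTao

namespace PlugDataPlus

/-! ## §1 Locality of the averaged charges -/

section Charges

variable {η : ℝ → ℝ} {r : ℝ} {V : Set E3} {g g' k k' : E3 → E3 →L[ℝ] E3 →L[ℝ] ℝ}

/-- For an admissible bump (`η = 0` off `(1, 2)`) the radial weight `η_r` vanishes off the open annulus `{r < |x| < 2r}`.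
[cite: MaoOhTao2023, §1.2 (1.7)] -/
theorem wt_eq_zero_of_not_mem (hη : IsBump η) (hr : 0 < r) {x : E3} (hx : ¬(r < ‖x‖ ∧ ‖x‖ < 2 * r)) :
    wt η r x = 0 := by
  obtain ⟨-, h1, h2, -⟩ := hη
  unfold wt
  rcases not_and_or.1 hx with h | h
  · rw [h1 _ ((div_le_one hr).2 (not_lt.1 h)), mul_zero]
  · rw [h2 _ ((le_div_iff₀ hr).2 (by linarith [not_lt.1 h])), mul_zero]

/-- Components of fields agreeing on an open set agree there, with their coordinate derivatives. [folklore] -/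
theorem pd_cmp_congr (hV : IsOpen V) (hg : ∀ x ∈ V, g' x = g x) {x : E3} (hx : x ∈ V) (l i j : Fin 3) :
    pd l (cmp g' i j) x = pd l (cmp g i j) x := by
  have h : cmp g' i j =ᶠ[𝓝 x] cmp g i j := by
    filter_upwards [hV.mem_nhds hx] with y hy
    simp only [MaoOhTao.cmp, hg y hy]
  unfold pd
  rw [h.fderiv_eq]

/-- Components of fields agreeing on a set agree there. [folklore] -/
theorem cmp_congr (hg : ∀ x ∈ V, g' x = g x) {x : E3} (hx : x ∈ V) (i j : Fin 3) :
    cmp g' i j x = cmp g i j x := by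
  simp only [MaoOhTao.cmp, hg x hx]

/-- Euclidean traces of fields agreeing on a set agree there. [folklore] -/
theorem trδ_congr (hk : ∀ x ∈ V, k' x = k x) {x : E3} (hx : x ∈ V) : trδ k' x = trδ k x := by
  simp only [trδ, cmp_congr hk hx]

/-- **Locality of the averaged energy**: fields agreeing on an open set containing `{r < |x| < 2r}` have the same `E[·; A_r]`.
[cite: MaoOhTao2023, §1.2 (1.3), (1.7)] -/
theorem avgE_congr (hη : IsBump η) (hr : 0 < r) (hV : IsOpen V) (hAV : ∀ x : E3, r < ‖x‖ → ‖x‖ < 2 * r → x ∈ V)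
    (hg : ∀ x ∈ V, g' x = g x) : avgE η r g' = avgE η r g := by
  unfold avgE
  congr 1
  refine integral_congr_ae (Eventually.of_forall fun x ↦ ?_)
  by_cases hx : r < ‖x‖ ∧ ‖x‖ < 2 * r
  · simp only [pd_cmp_congr hV hg (hAV x hx.1 hx.2)]
  · simp only [wt_eq_zero_of_not_mem hη hr hx, zero_mul]

/-- **Locality of the averaged linear momentum.** [cite: MaoOhTao2023, §1.2 (1.4), (1.7)] -/
theorem avgP_congr (hη : IsBump η) (hr : 0 < r) (hAV : ∀ x : E3, r < ‖x‖ → ‖x‖ < 2 * r → x ∈ V)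
    (hk : ∀ x ∈ V, k' x = k x) : avgP η r k' = avgP η r k := by
  funext i
  unfold avgP
  refine integral_congr_ae (Eventually.of_forall fun x ↦ ?_)
  by_cases hx : r < ‖x‖ ∧ ‖x‖ < 2 * r
  · simp only [cmp_congr hk (hAV x hx.1 hx.2), trδ_congr hk (hAV x hx.1 hx.2)]
  · simp only [wt_eq_zero_of_not_mem hη hr hx, zero_mul]

/-- **Locality of the averaged centre of mass.** [cite: MaoOhTao2023, §1.2 (1.5), (1.7)] -/
theorem avgC_congr (hη : IsBump η) (hr : 0 < r) (hV : IsOpen V) (hAV : ∀ x : E3, r < ‖x‖ → ‖x‖ < 2 * r → x ∈ V)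
    (hg : ∀ x ∈ V, g' x = g x) : avgC η r g' = avgC η r g := by
  funext l
  unfold avgC
  congr 1
  refine integral_congr_ae (Eventually.of_forall fun x ↦ ?_)
  by_cases hx : r < ‖x‖ ∧ ‖x‖ < 2 * r
  · simp only [pd_cmp_congr hV hg (hAV x hx.1 hx.2), cmp_congr hg (hAV x hx.1 hx.2)]
  · simp only [wt_eq_zero_of_not_mem hη hr hx, zero_mul]

/-- **Locality of the averaged angular momentum.** [cite: MaoOhTao2023, §1.2 (1.6), (1.7)] -/
theorem avgJ_congr (hη : IsBump η) (hr : 0 < r) (hAV : ∀ x : E3, r < ‖x‖ → ‖x‖ < 2 * r → x ∈ V)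
    (hk : ∀ x ∈ V, k' x = k x) : avgJ η r k' = avgJ η r k := by
  funext l
  unfold avgJ
  refine integral_congr_ae (Eventually.of_forall fun x ↦ ?_)
  by_cases hx : r < ‖x‖ ∧ ‖x‖ < 2 * r
  · simp only [cmp_congr hk (hAV x hx.1 hx.2), trδ_congr hk (hAV x hx.1 hx.2)]
  · simp only [wt_eq_zero_of_not_mem hη hr hx, zero_mul]

end Charges

/-! ## §2 Locality of the deviation -/

section Deviation

variable {g g' k k' : E3 → E3 →L[ℝ] E3 →L[ℝ] ℝ} {a b s : ℝ} {V : Set E3}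

set_option synthInstance.maxHeartbeats 120000 in
-- the operator norm on `E3 [×m]→L[ℝ] (E3 →L[ℝ] E3 →L[ℝ] ℝ)` needs a longer instance search than the default budget
/-- **Locality of the `C² × C¹` deviation**: fields agreeing on an open set containing the closed annulus `{a ≤ |x| ≤ b}` have
the same deviation bounds there (iterated derivatives are local). [folklore] -/
theorem devLE_congr (hV : IsOpen V) (hAV : ∀ x : E3, a ≤ ‖x‖ → ‖x‖ ≤ b → x ∈ V) (hg : ∀ x ∈ V, g' x = g x)
    (hk : ∀ x ∈ V, k' x = k x) (h : DevLE g k a b s) : DevLE g' k' a b s := by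
  intro x hxa hxb
  have hxV : V ∈ 𝓝 x := hV.mem_nhds (hAV x hxa hxb)
  have hge : (fun y ↦ g' y - (innerSL ℝ : E3 →L[ℝ] E3 →L[ℝ] ℝ)) =ᶠ[𝓝 x]
      (fun y ↦ g y - (innerSL ℝ : E3 →L[ℝ] E3 →L[ℝ] ℝ)) := by
    filter_upwards [hxV] with y hy
    rw [hg y hy]
  have hke : k' =ᶠ[𝓝 x] k := by
    filter_upwards [hxV] with y hy
    exact hk y hy
  obtain ⟨h1, h2⟩ := h x hxa hxb
  refine ⟨fun m hm ↦ ?_, fun m hm ↦ ?_⟩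
  · rw [(hge.iteratedFDeriv ℝ m).eq_of_nhds]
    exact h1 m hm
  · rw [(hke.iteratedFDeriv ℝ m).eq_of_nhds]
    exact h2 m hm

end Deviation

/-! ## §3 The flat pair -/

section Flat

variable (η : ℝ → ℝ) (r : ℝ)

/-- The components of the flat metric field: `δ_{ij}`. [folklore] -/
theorem cmp_flat (i j : Fin 3) (x : E3) :
    cmp (fun _ : E3 ↦ (innerSL ℝ : E3 →L[ℝ] E3 →L[ℝ] ℝ)) i j x = if i = j then 1 else 0 := by
  simp only [MaoOhTao.cmp]
  exact orthonormal_iff_ite.1 EuclideanSpace.orthonormal_single i j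

/-- The components of the flat metric field are constant: `∂_l δ_{ij} = 0`. [folklore] -/
theorem pd_cmp_flat (l i j : Fin 3) (x : E3) :
    pd l (cmp (fun _ : E3 ↦ (innerSL ℝ : E3 →L[ℝ] E3 →L[ℝ] ℝ)) i j) x = 0 := by
  have hc : cmp (fun _ : E3 ↦ (innerSL ℝ : E3 →L[ℝ] E3 →L[ℝ] ℝ)) i j = fun _ ↦ if i = j then (1 : ℝ) else 0 :=
    funext (cmp_flat i j)
  simp only [pd, hc, fderiv_fun_const, Pi.zero_apply, zero_apply]

/-- The components of the zero field vanish. [folklore] -/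
theorem cmp_zero (i j : Fin 3) (x : E3) : cmp (fun _ : E3 ↦ (0 : E3 →L[ℝ] E3 →L[ℝ] ℝ)) i j x = 0 := rfl

/-- The Euclidean trace of the zero field vanishes. [folklore] -/
theorem trδ_zero (x : E3) : trδ (fun _ : E3 ↦ (0 : E3 →L[ℝ] E3 →L[ℝ] ℝ)) x = 0 := by
  simp only [trδ, cmp_zero, Finset.sum_const_zero]

/-- The flat field has averaged energy `0`. [cite: MaoOhTao2023, §1.2 (1.3)] -/
theorem avgE_flat : avgE η r (fun _ : E3 ↦ (innerSL ℝ : E3 →L[ℝ] E3 →L[ℝ] ℝ)) = 0 := by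
  simp only [avgE, pd_cmp_flat, sub_self, zero_mul, Finset.sum_const_zero, mul_zero, integral_zero]

/-- The flat field has averaged centre of mass `0`. [cite: MaoOhTao2023, §1.2 (1.5)] -/
theorem avgC_flat (l : Fin 3) : avgC η r (fun _ : E3 ↦ (innerSL ℝ : E3 →L[ℝ] E3 →L[ℝ] ℝ)) l = 0 := by
  have h0 : ∀ (x : E3) (i j : Fin 3),
      (x l * pd i (cmp (fun _ : E3 ↦ (innerSL ℝ : E3 →L[ℝ] E3 →L[ℝ] ℝ)) i j) x
        - x l * pd j (cmp (fun _ : E3 ↦ (innerSL ℝ : E3 →L[ℝ] E3 →L[ℝ] ℝ)) i i) x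
        - (if i = l then cmp (fun _ : E3 ↦ (innerSL ℝ : E3 →L[ℝ] E3 →L[ℝ] ℝ)) i j x - (if i = j then 1 else 0) else 0)
        + (if j = l then cmp (fun _ : E3 ↦ (innerSL ℝ : E3 →L[ℝ] E3 →L[ℝ] ℝ)) i i x - 1 else 0)) = 0 := by
    intro x i j
    simp only [pd_cmp_flat, cmp_flat, mul_zero, sub_self, if_true]
    split_ifs <;> simp
  simp only [avgC, h0, zero_mul, Finset.sum_const_zero, mul_zero, integral_zero]

/-- The zero field has averaged linear momentum `0`. [cite: MaoOhTao2023, §1.2 (1.4)] -/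
theorem avgP_zero (i : Fin 3) : avgP η r (fun _ : E3 ↦ (0 : E3 →L[ℝ] E3 →L[ℝ] ℝ)) i = 0 := by
  simp only [avgP, cmp_zero, trδ_zero, ite_self, sub_self, zero_mul, Finset.sum_const_zero, mul_zero, integral_zero]

/-- The zero field has averaged angular momentum `0`. [cite: MaoOhTao2023, §1.2 (1.6)] -/
theorem avgJ_zero (l : Fin 3) : avgJ η r (fun _ : E3 ↦ (0 : E3 →L[ℝ] E3 →L[ℝ] ℝ)) l = 0 := by
  simp only [avgJ, cmp_zero, trδ_zero, ite_self, sub_self, zero_mul, Finset.sum_const_zero, mul_zero, integral_zero]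

set_option synthInstance.maxHeartbeats 120000 in
-- the operator norm on `E3 [×m]→L[ℝ] (E3 →L[ℝ] E3 →L[ℝ] ℝ)` needs a longer instance search than the default budget
/-- The flat pair `(δ, 0)` has `C² × C¹` deviation `0` on every annulus. [folklore] -/
theorem devLE_flat (a b : ℝ) :
    DevLE (fun _ : E3 ↦ (innerSL ℝ : E3 →L[ℝ] E3 →L[ℝ] ℝ)) (fun _ : E3 ↦ (0 : E3 →L[ℝ] E3 →L[ℝ] ℝ)) a b 0 := by
  intro x _ _
  have h0 : (fun _ : E3 ↦ (innerSL ℝ : E3 →L[ℝ] E3 →L[ℝ] ℝ) - (innerSL ℝ : E3 →L[ℝ] E3 →L[ℝ] ℝ)) =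
      fun _ ↦ (0 : E3 →L[ℝ] E3 →L[ℝ] ℝ) := funext fun _ ↦ sub_self _
  refine ⟨fun m _ ↦ ?_, fun m _ ↦ ?_⟩
  · rw [h0]
    simp only [iteratedFDeriv_fun_zero, Pi.zero_apply, norm_zero, le_refl]
  · simp only [iteratedFDeriv_fun_zero, Pi.zero_apply, norm_zero, le_refl]

end Flat

end PlugDataPlus

/-- **Registered anchor of this helper file** (sub-goal `plugDataPlusFromOfAux2_anchor` of stub `stub_plugDataPlusFrom_of`):
the radial weight of an admissible bump vanishes off the open annulus, `PlugDataPlus.wt_eq_zero_of_not_mem`.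
[cite: MaoOhTao2023, §1.2 (1.7)] -/
theorem plugDataPlusFromOfAux2_anchor : ∀ (η : ℝ → ℝ) (r : ℝ), IsBump η → 0 < r → ∀ x : E3, ¬(r < ‖x‖ ∧ ‖x‖ < 2 * r) → wt η r x = 0 :=
  fun _ _ hη hr _ hx ↦ PlugDataPlus.wt_eq_zero_of_not_mem hη hr hx

end Summit.FinalStateConjecture.FinalStateConjecture.Theorems.SwallowTheDatum.UniversalWitnessFamily

end
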